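import Summits.BirchSwinnertonDyer.BirchSwinnertonDyer.Theorems.KatoDescentPotSupersingularWildUpperDivisionFieldClassNumberDoor
import Literature.NumberTheory.EllipticCurves.FineSelmerMuRoadDoorsUnconditional
import HarnessLib

/-!
# Route `KatoDescentPotSupersingular` (rung K9, sub-rung B5 = O6 wild `p = 3`, cell `bsd-potss`): the IMAGE-FREE class-group μ-road doors
# WITHOUT the named fact Coates–Sujatha Thm. 3.4 — statement (A) at `(W, p)` and U₀ `MissingUpperBoundAt W 3` on an irreducible rank-`0` O6 row
# from class-group integers of `ℚ(W[p])` alone (seat `bsd-potss-k8t-c4` g21, courtesy for the K9 record lane; route-free;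
# `--supports stmt-BirchSwinnertonDyer-19197 --as helper`)

HONEST FRAMING. THEOREMS ONLY (no definition, no named fact, no `sorry`); nothing is booked; items 19189 / 19197 / 19942 stay OPEN at class
level; (A), Conjecture A and BSD are proved for NO curve as a class — each door converts them, for ONE curve and ONE odd prime, into finitely many
displayed integers.

WHAT CHANGED (k8t-c4 g21). Coates–Sujatha 2005 Thm. 3.4 is now a tree theorem in the form the class-group doors consume
(`CoatesSujatha2005.fineSelmerDual_moduleFinite_of_forall_classGroupPRank_le`: bounded `rank_p Cl` along the cyclotomic tower of `ℚ(W[p])` ⟹ (A)),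
so the doors Iwasawa 1956 / Fukuda (1) / Fukuda (2) ⟹ (A) hold with NO named fact (`FineSelmerMuRoadDoorsUnconditional`). This file is the K9 Summits
layer: the `hCS`-FREE twins of `DivisionFieldClassNumberDoor.{missingUpperBoundAt_three_of_not_dvd_classNumber_divisionField_of_unique_prime,
missingUpperBoundAt_three_of_unique_prime_of_involutions}` (k9-c4 g22; the (A)-level twins live route-free in Literature
`FineSelmerMuRoadDoorsUnconditional` and in the KT file `…ImageFreeMuRoadDoorsNoCS`), composed through k9-c4 g5's (A)-form port
`WildFineSelmerSupersingularCMAnchor.missingUpperBoundAt_wild_of_conjA`. Remaining named facts for U₀: `hKatoA hGZK hmod` only; (A) needs NONE.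

References: [CoatesSujatha2005] Thm. 3.4 (§3); [Greenberg2001IwasawaPastPresent] Prop. 2.1; [Fukuda1994] Thm. 1; [Kato2004Asterisque] Thm. 12.5 (3),
14.5 (3); [Washington1997] Thm. 10.4, Prop. 13.22; [NeukirchANT1999] Ch. III §1 (1.6) (iv).
-/

set_option linter.dupNamespace false
set_option autoImplicit false

noncomputable section

open scoped NumberField
open Field IntermediateField WeierstrassCurve IsDedekindDomain Literature.NumberTheory.EllipticCurves
  Literature.NumberTheory.GaloisRepresentations Literature.NumberTheory.SerreUniformity
  Literature.NumberTheory.IwasawaTheory Literature.NumberTheory.EllipticCurves.Rank1Residual.Typed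
  Summit.BirchSwinnertonDyer.Rank1Residual.Additive

namespace Summit.BirchSwinnertonDyer.BirchSwinnertonDyer.Theorems.DivisionFieldClassNumberDoorNoCS

/-! The (A)-level doors (NO named fact) are `ImageFreeMuRoadDoorsNoCS.conjA_…` (KT Summits file) and, route-free, the Literature theorems
`CoatesSujatha2005.fineSelmerDual_moduleFinite_of_not_dvd_classNumber_of_unique_prime'` etc.; here only the K9 U₀ compositions. -/

/-! ## §2 U₀ `MissingUpperBoundAt W 3` on an irreducible rank-`0` O6 row — `hKatoA hGZK hmod` + numerics, NO `hCS` -/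

section Upper

variable (W : WeierstrassCurve ℚ) [W.IsElliptic] [W.IsGloballyMinimal]

/-- **U₀ at an irreducible rank-`0` O6 row from two class-group integers of `ℚ(W[3])`, without Coates–Sujatha as a hypothesis**: the `hCS`-free
twin of `DivisionFieldClassNumberDoor.missingUpperBoundAt_three_of_not_dvd_classNumber_divisionField_of_unique_prime` (k9-c4 g22): `MissingUpperBoundAt W 3`
for `r_an = 0`, `ClassO6 W 3`, `W[3]` irreducible, from the named facts A161-fine `hKatoA`, GZK `hGZK`, modularity `hmod`, and the displayed
`hh : 3 ∤ h(ℚ(W[3]))`, `hv` (one prime above `3`). CONDITIONAL on `hKatoA hGZK hmod`; nothing booked; BSD for no curve.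
[cite: Kato2004Asterisque, Thm. 14.5 (3) (p. 236), Thm. 12.5 (3) (p. 222)] [cite: CoatesSujatha2005, Thm. 3.4 (§3)]
[cite: Greenberg2001IwasawaPastPresent, Prop. 2.1 p. 339] [cite: Washington1997, Thm. 10.4, Prop. 13.22] -/
theorem missingUpperBoundAt_three_of_not_dvd_classNumber_divisionField_of_unique_prime
    (hKatoA : Kato2004.rankZero_padicValNat_sha_add_padicValNat_tamagawa_le_of_additive_potGood_of_irreducible_of_fineSelmerDual_fg)
    (hGZK : rank_eq_analyticRank_of_analyticRank_le_one) (hmod : hasEntireLFunction_rat) [Fact (3 : ℕ).Prime]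
    (hr : W.analyticRank = 0) (hO : ClassO6 W 3) (hirr : W.HasIrreducibleModPGaloisRep 3)
    (hh : haveI : NumberField (W.divisionField 3) := NumberField.mk
      ¬ 3 ∣ NumberField.classNumber (W.divisionField 3))
    (hv : haveI : NumberField (W.divisionField 3) := NumberField.mk
      ∃! v : HeightOneSpectrum (𝓞 (W.divisionField 3)), ((3 : ℕ) : 𝓞 (W.divisionField 3)) ∈ v.asIdeal) :
    MissingUpperBoundAt W 3 :=
  WildFineSelmerSupersingularCMAnchor.missingUpperBoundAt_wild_of_conjA hKatoA hGZK hmod W hr hO hirr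
    (CoatesSujatha2005.fineSelmerDual_moduleFinite_of_not_dvd_classNumber_of_unique_prime' W 3 (by decide) hh hv)

/-- **U₀ at an irreducible rank-`0` O6 row from the GRH-free INVOLUTION certificate of `ℚ(W[3])`, without `hCS`**: the `hCS`-free twin of
`DivisionFieldClassNumberDoor.missingUpperBoundAt_three_of_unique_prime_of_involutions`. CONDITIONAL on `hKatoA hGZK hmod`; nothing booked; BSD for no curve.
[cite: Kato2004Asterisque, Thm. 14.5 (3) (p. 236)] [cite: NeukirchANT1999, Ch. III §1 Prop. (1.6) (iv)] [cite: CoatesSujatha2005, Thm. 3.4 (§3)] -/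
theorem missingUpperBoundAt_three_of_unique_prime_of_involutions
    (hKatoA : Kato2004.rankZero_padicValNat_sha_add_padicValNat_tamagawa_le_of_additive_potGood_of_irreducible_of_fineSelmerDual_fg)
    (hGZK : rank_eq_analyticRank_of_analyticRank_le_one) (hmod : hasEntireLFunction_rat) [Fact (3 : ℕ).Prime]
    (hr : W.analyticRank = 0) (hO : ClassO6 W 3) (hirr : W.HasIrreducibleModPGaloisRep 3) (τb τg τz : absoluteGaloisGroup ℚ)
    (hb : ∀ T : geomTorsion W ((3 : ℕ) : ℤ), τb • (τb • T) = T) (hz : ∀ T : geomTorsion W ((3 : ℕ) : ℤ), τz • (τz • T) = T)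
    (hrel : ∀ T : geomTorsion W ((3 : ℕ) : ℤ), τz • T = τb • (τg • (τb • (τg⁻¹ • T))))
    (hKb : haveI : NumberField (W.divisionField 3) := NumberField.mk
      ¬ 3 ∣ NumberField.classNumber (fixedField (Subgroup.zpowers (absRestrictNormalHom (W.divisionField 3) τb))))
    (hKz : haveI : NumberField (W.divisionField 3) := NumberField.mk
      ¬ 3 ∣ NumberField.classNumber (fixedField (Subgroup.zpowers (absRestrictNormalHom (W.divisionField 3) τz))))
    (hv : haveI : NumberField (W.divisionField 3) := NumberField.mk
      ∃! v : HeightOneSpectrum (𝓞 (W.divisionField 3)), ((3 : ℕ) : 𝓞 (W.divisionField 3)) ∈ v.asIdeal) :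
    MissingUpperBoundAt W 3 :=
  WildFineSelmerSupersingularCMAnchor.missingUpperBoundAt_wild_of_conjA hKatoA hGZK hmod W hr hO hirr
    (CoatesSujatha2005.fineSelmerDual_moduleFinite_of_not_dvd_classNumber_of_unique_prime' W 3 (by decide)
      (DivisionField.not_dvd_classNumber_divisionField_of_involutions W 3 (by decide) τb τg τz hb hz hrel hKb hKz) hv)

end Upper

end Summit.BirchSwinnertonDyer.BirchSwinnertonDyer.Theorems.DivisionFieldClassNumberDoorNoCS

end
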